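import Mathlib
import HarnessLib

/-!
# Route `WeakCouplingBCS` — crux `WcbcsBcsConstruction` (stmt-HubbardSuperconductivity-2010),
# line `lro-seed-kink-bridge`, stub `stub_eosTransfer`

Pure real analysis (the "equation-of-state transfer"). A family `e h : ℝ → ℝ` (`0 < h < h₀`) of
functions, each differentiable on a window `[μ₁, μ₂]` with derivative `n h`, such that the
derivatives are equicontinuous on the window uniformly in `h` and `|e h μ - e₀ μ| ≤ B h` there,
has a `C¹` limit on the open window: `e₀' = n₀ := lim_{h → 0⁺} n h` on `(μ₁, μ₂)`, and `n₀`
inherits the modulus of continuity. In the crux this is how a construction that works WITH a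
symmetry-breaking source `h > 0` (infrared regulator) and controls the sourced ground-state energy
densities uniformly as `h ↓ 0` discharges the regularity of the `h = 0` equation of state needed by
Griffiths' lemma (`exists_tendsto_gcDensity_of_regularWindow`).

Proof. (a) Mean value inequality on the segment `[μ, μ']` applied to `t ↦ e h t - t · n h μ`:
`|e h μ' - e h μ - (μ' - μ) n h μ| ≤ ε |μ' - μ|` once `|μ' - μ| < η(ε)`.
(b) For interior `μ` and the fixed comparison point `μ' = μ + ρ` (`0 < ρ < η`), (a) at two sources
`h, h'` and the rate bound give `ρ |n h μ - n h' μ| ≤ 2 ε ρ + 2 B (h + h')`, so `h ↦ n h μ` is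
Cauchy along `𝓝[>] 0` and converges (completeness of `ℝ`) to some `n₀ μ`.
(c) (a) plus the rate bound: `|e₀ μ' - e₀ μ - (μ' - μ) n h μ| ≤ ε |μ' - μ| + 2 B h`; letting
`h → 0⁺` gives `HasDerivAt e₀ (n₀ μ) μ`. (d) Let `h → 0⁺` in `|n h μ - n h μ'| < ε`.
-/

noncomputable section

set_option linter.dupNamespace false

namespace Summit.HubbardSuperconductivity.HubbardSuperconductivity.Theorems

open Filter Set
open scoped Topology

/-- **Mean value step.** If `f` has derivative `f' z` at every point `z` of `[a, b]` and
`|f' z - f' x| < ε` whenever `z ∈ [a, b]` is `η`-close to `x ∈ [a, b]`, then for `y ∈ [a, b]` with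
`|y - x| < η` one has `|f y - f x - (y - x) f' x| ≤ ε |y - x|` (mean value inequality for
`t ↦ f t - t · f' x` on the segment `[x, y] ⊆ [a, b]`). [folklore] -/
theorem abs_sub_sub_mul_deriv_le_of_modulus {f f' : ℝ → ℝ} {a b x y ε η : ℝ}
    (hf : ∀ z ∈ Icc a b, HasDerivAt f (f' z) z)
    (hmod : ∀ z ∈ Icc a b, |z - x| < η → |f' z - f' x| < ε)
    (hx : x ∈ Icc a b) (hy : y ∈ Icc a b) (hxy : |y - x| < η) :
    |f y - f x - (y - x) * f' x| ≤ ε * |y - x| := by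
  have hsub : uIcc x y ⊆ Icc a b := uIcc_subset_Icc hx hy
  have key : |f y - y * f' x - (f x - x * f' x)| ≤ ε * |y - x| := by
    have := (convex_uIcc x y).norm_image_sub_le_of_norm_hasDerivWithin_le
      (f := fun t => f t - t * f' x) (f' := fun z => f' z - f' x) (C := ε)
      (fun z hz => ((hf z (hsub hz)).sub (hasDerivAt_mul_const (f' x))).hasDerivWithinAt)
      (fun z hz => (hmod z (hsub hz) ((abs_sub_left_of_mem_uIcc hz).trans_lt hxy)).le)
      left_mem_uIcc right_mem_uIcc
    simpa only [Real.norm_eq_abs] using this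
  calc |f y - f x - (y - x) * f' x| = |f y - y * f' x - (f x - x * f' x)| := by congr 1; ring
    _ ≤ ε * |y - x| := key

/-- **Completeness step.** A real net that is Cauchy along `𝓝[>] 0` converges. [folklore] -/
theorem exists_tendsto_nhdsGT_zero_of_cauchy {g : ℝ → ℝ}
    (hg : ∀ ε > 0, ∃ δ > 0, ∀ h ∈ Ioo 0 δ, ∀ h' ∈ Ioo 0 δ, |g h - g h'| < ε) :
    ∃ a, Tendsto g (𝓝[>] 0) (𝓝 a) := by
  refine cauchy_map_iff_exists_tendsto.1 (Metric.cauchy_iff.2 ⟨inferInstance, fun ε hε => ?_⟩)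
  obtain ⟨δ, hδ, H⟩ := hg ε hε
  refine ⟨g '' Ioo 0 δ, image_mem_map (Ioo_mem_nhdsGT hδ), ?_⟩
  rintro _ ⟨h, hh, rfl⟩ _ ⟨h', hh', rfl⟩
  rw [Real.dist_eq]
  exact H h hh h' hh'

/-- **Limit step.** Passing to the limit `h → 0⁺` in a bound `F (g h) ≤ x + C h` valid for
`0 < h < h₀`, for a continuous `F` and a net `g h → a`: `F a ≤ x`. [folklore] -/
theorem apply_le_of_tendsto_nhdsGT_zero {E : Type*} [TopologicalSpace E] {g : ℝ → E} {a : E}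
    (hg : Tendsto g (𝓝[>] 0) (𝓝 a)) (F : E → ℝ) (hF : Continuous F) {x h₀ : ℝ} (C : ℝ)
    (hh₀ : 0 < h₀) (H : ∀ h ∈ Ioo 0 h₀, F (g h) ≤ x + C * h) : F a ≤ x := by
  have h2 : Tendsto (fun h : ℝ => x + C * h) (𝓝[>] 0) (𝓝 (x + C * 0)) :=
    ((continuous_const.add (continuous_const.mul continuous_id)).tendsto 0).mono_left
      nhdsWithin_le_nhds
  rw [mul_zero, add_zero] at h2
  exact le_of_tendsto_of_tendsto ((hF.tendsto a).comp hg) h2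
    (by filter_upwards [Ioo_mem_nhdsGT hh₀] with h hh using H h hh)

/-- **Stub `stub_eosTransfer`** of the line `lro-seed-kink-bridge` (crux `WcbcsBcsConstruction`):
uniform-in-`h` `C¹` passes to the `h = 0` limit. If `|e h μ - e₀ μ| ≤ B h` on `[μ₁, μ₂]` for
`0 < h < h₀`, each `e h` has derivative `n h μ` at every `μ ∈ [μ₁, μ₂]`, and the `n h` are
equicontinuous on `[μ₁, μ₂]` uniformly in `h`, then there is `n₀` with `HasDerivAt e₀ (n₀ μ) μ` and
`n h μ → n₀ μ` as `h → 0⁺` for every `μ ∈ (μ₁, μ₂)`, and `n₀` has the same modulus of continuity on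
`(μ₁, μ₂)`. [folklore] -/
theorem stub_eosTransfer :
    ∀ (e : ℝ → ℝ → ℝ) (e₀ : ℝ → ℝ) (n : ℝ → ℝ → ℝ) (B h₀ μ₁ μ₂ : ℝ), 0 < h₀ → μ₁ < μ₂ →
      (∀ h ∈ Set.Ioo 0 h₀, ∀ μ ∈ Set.Icc μ₁ μ₂, |e h μ - e₀ μ| ≤ B * h) →
      (∀ h ∈ Set.Ioo 0 h₀, ∀ μ ∈ Set.Icc μ₁ μ₂, HasDerivAt (e h) (n h μ) μ) →
      (∀ ε > 0, ∃ η > 0, ∀ h ∈ Set.Ioo 0 h₀, ∀ μ ∈ Set.Icc μ₁ μ₂, ∀ μ' ∈ Set.Icc μ₁ μ₂,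
          |μ - μ'| < η → |n h μ - n h μ'| < ε) →
      ∃ n₀ : ℝ → ℝ, (∀ μ ∈ Set.Ioo μ₁ μ₂, HasDerivAt e₀ (n₀ μ) μ) ∧
        (∀ μ ∈ Set.Ioo μ₁ μ₂, Tendsto (fun h => n h μ) (𝓝[>] 0) (𝓝 (n₀ μ))) ∧
        (∀ ε > 0, ∃ η > 0, ∀ μ ∈ Set.Ioo μ₁ μ₂, ∀ μ' ∈ Set.Ioo μ₁ μ₂, |μ - μ'| < η → |n₀ μ - n₀ μ'| ≤ ε) := by
  intro e e₀ n B h₀ μ₁ μ₂ hh₀ _hμ₁₂ hclose hder hequi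
  -- WLOG the rate constant is positive: replace `B` by `B' = max B 1`.
  obtain ⟨B', hB', hclose'⟩ :
      ∃ B' : ℝ, 0 < B' ∧ ∀ h ∈ Ioo 0 h₀, ∀ μ ∈ Icc μ₁ μ₂, |e h μ - e₀ μ| ≤ B' * h :=
    ⟨max B 1, lt_max_of_lt_right one_pos, fun h hh μ hμ =>
      (hclose h hh μ hμ).trans (mul_le_mul_of_nonneg_right (le_max_left _ _) hh.1.le)⟩
  clear hclose
  -- (b) For interior `μ` the net `h ↦ n h μ` is Cauchy along `𝓝[>] 0`, hence converges.
  have hlim : ∀ μ ∈ Ioo μ₁ μ₂, ∃ a, Tendsto (fun h => n h μ) (𝓝[>] 0) (𝓝 a) := by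
    intro μ hμ
    have hμI : μ ∈ Icc μ₁ μ₂ := Ioo_subset_Icc_self hμ
    refine exists_tendsto_nhdsGT_zero_of_cauchy fun ε hε => ?_
    obtain ⟨η, hη, hmod⟩ := hequi (ε / 8) (by positivity)
    -- the comparison point `μ + ρ ∈ [μ₁, μ₂]`, `0 < ρ < η`
    obtain ⟨ρ, hρ, hρη, hρ₂⟩ : ∃ ρ : ℝ, 0 < ρ ∧ ρ < η ∧ μ + ρ ≤ μ₂ :=
      ⟨min (η / 2) ((μ₂ - μ) / 2), lt_min (by positivity) (by linarith [hμ.2]),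
        (min_le_left _ _).trans_lt (by linarith),
        by linarith [min_le_right (η / 2) ((μ₂ - μ) / 2), hμ.2]⟩
    have hμ'I : μ + ρ ∈ Icc μ₁ μ₂ := ⟨by linarith [hμ.1], hρ₂⟩
    have hd : |μ + ρ - μ| < η := by rwa [add_sub_cancel_left, abs_of_pos hρ]
    have hερ : 0 < ε * ρ := mul_pos hε hρ
    refine ⟨min h₀ (ε / 8 * ρ / B'), lt_min hh₀ (by positivity), fun h hh h' hh' => ?_⟩
    have hsmall : ∀ k ∈ Ioo 0 (min h₀ (ε / 8 * ρ / B')), k ∈ Ioo 0 h₀ ∧ B' * k < ε / 8 * ρ :=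
      fun k hk => ⟨⟨hk.1, hk.2.trans_le (min_le_left _ _)⟩, by
        have := hk.2.trans_le (min_le_right _ _); rwa [lt_div_iff₀ hB', mul_comm] at this⟩
    obtain ⟨hh, hBh⟩ := hsmall h hh
    obtain ⟨hh', hBh'⟩ := hsmall h' hh'
    have A := abs_sub_sub_mul_deriv_le_of_modulus (hder h hh)
      (fun z hz hzx => hmod h hh z hz μ hμI hzx) hμI hμ'I hd
    have A' := abs_sub_sub_mul_deriv_le_of_modulus (hder h' hh')
      (fun z hz hzx => hmod h' hh' z hz μ hμI hzx) hμI hμ'I hd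
    rw [add_sub_cancel_left, abs_of_pos hρ] at A A'
    have C₁ := hclose' h hh (μ + ρ) hμ'I
    have C₂ := hclose' h' hh' (μ + ρ) hμ'I
    have C₃ := hclose' h hh μ hμI
    have C₄ := hclose' h' hh' μ hμI
    rw [abs_le] at A A' C₁ C₂ C₃ C₄
    have key : |ρ * (n h μ - n h' μ)| < ρ * ε := by
      rw [abs_lt]; constructor <;> linarith
    rw [abs_mul, abs_of_pos hρ] at key
    exact lt_of_mul_lt_mul_left key hρ.le
  choose! n₀ hn₀ using hlim
  refine ⟨n₀, fun μ hμ => ?_, hn₀, fun ε hε => ?_⟩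
  · -- (c) `HasDerivAt e₀ (n₀ μ) μ` for interior `μ`
    have hμI : μ ∈ Icc μ₁ μ₂ := Ioo_subset_Icc_self hμ
    rw [hasDerivAt_iff_isLittleO, Asymptotics.isLittleO_iff]
    intro c hc
    obtain ⟨η, hη, hmod⟩ := hequi (c / 2) (by positivity)
    have hr : 0 < min η (min (μ - μ₁) (μ₂ - μ)) :=
      lt_min hη (lt_min (by linarith [hμ.1]) (by linarith [hμ.2]))
    filter_upwards [Metric.ball_mem_nhds μ hr] with x hx
    rw [Metric.mem_ball, Real.dist_eq, lt_min_iff, lt_min_iff] at hx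
    obtain ⟨hxη, hx₁, hx₂⟩ := hx
    have hxI : x ∈ Icc μ₁ μ₂ := by
      rw [abs_lt] at hx₁ hx₂
      constructor <;> linarith
    rw [Real.norm_eq_abs, Real.norm_eq_abs, smul_eq_mul]
    have key : |e₀ x - e₀ μ - (x - μ) * n₀ μ| ≤ c / 2 * |x - μ| := by
      refine apply_le_of_tendsto_nhdsGT_zero (hn₀ μ hμ) (fun t => |e₀ x - e₀ μ - (x - μ) * t|)
        (by fun_prop) (2 * B') hh₀ fun h hh => ?_
      show |e₀ x - e₀ μ - (x - μ) * n h μ| ≤ c / 2 * |x - μ| + 2 * B' * h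
      have A := abs_sub_sub_mul_deriv_le_of_modulus (hder h hh)
        (fun z hz hzx => hmod h hh z hz μ hμI hzx) hμI hxI hxη
      have C₁ := hclose' h hh x hxI
      have C₃ := hclose' h hh μ hμI
      rw [abs_le] at A C₁ C₃ ⊢
      constructor <;> linarith
    exact key.trans (mul_le_mul_of_nonneg_right (by linarith) (abs_nonneg _))
  · -- (d) the modulus of continuity of `n₀`
    obtain ⟨η, hη, hmod⟩ := hequi ε hε
    refine ⟨η, hη, fun μ hμ μ' hμ' hd => ?_⟩
    exact apply_le_of_tendsto_nhdsGT_zero ((hn₀ μ hμ).prodMk_nhds (hn₀ μ' hμ'))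
      (fun p : ℝ × ℝ => |p.1 - p.2|) (by fun_prop) 0 hh₀ fun h hh => by
        show |n h μ - n h μ'| ≤ ε + 0 * h
        rw [zero_mul, add_zero]
        exact (hmod h hh μ (Ioo_subset_Icc_self hμ) μ' (Ioo_subset_Icc_self hμ') hd).le

end Summit.HubbardSuperconductivity.HubbardSuperconductivity.Theorems
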